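import Literature.Geometry.Lorentzian.DyadicDecay
import HarnessLib

/-!
# The `r^p` hierarchy of arbitrary length with loss of derivatives: `τ^{-(L-p)}` decay
(abstract real-variable form of the iteration behind the *improved* decay estimates of
Schlue, Moschidis and Dafermos–Rodnianski–Shlapentokh-Rothman, Cor. 3.1, second estimate)

`DyadicDecay.lean` proves, once and for all, the two-level iteration of Dafermos–Rodnianski
(arXiv:0910.4957, §3–§4): boundedness, integrated local energy decay losing one derivative and the
`p = 1, 2` weighted estimates give `τ⁻²` decay of the energy flux. The *improved* decay rates —
`τ⁻⁴` for the energy of `Tφ` and for the higher-order energies, whence `|φ| ≲ τ^{-3/2}`,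
`|∂φ| ≲ τ⁻²` pointwise (Schlue, arXiv:1012.5963 = [Schlue2013]; Moschidis, arXiv:1509.08489, Thm. 9.1,
Cor. 9.2; on subextremal Kerr: Dafermos–Rodnianski–Shlapentokh-Rothman, arXiv:1402.7034, Cor. 3.1,
second estimate `∫_{Σ̃_τ ∩ {r ≤ R}} J^N[Nψ] n ≤ C E τ^{-4+2δ}` and (30)–(31)) — rest on a *longer*
hierarchy: after commutation with `∂_v` (and `r⁻¹∂_σ`) the `r^p`-weighted estimates hold for
`2k − 2 < p ≤ 2k` at commutation order `k` (Moschidis, Thm. 6.1), so that for `q = 2` one has a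
hierarchy of length `4`: levels `p = 4, 3` are the `k = 2` weighted energies of `φ`, levels
`p = 2, 1, 0` the `k = 1` weighted energies and the energy flux of `Tφ`, the passage at `p = 2`
being the wave equation written in null coordinates (`r²|∂_v(ΩTφ)|² ≲ r²|∂_v²(Ωφ)|² +
r⁻²|∂_σ²(Ωφ)|² + …`, Moschidis §9.4). The iteration which turns such a hierarchy into decay is
again elementary and independent of the PDE input; Schlue runs it as "a hierarchy of four steps"
(`p = 4−δ, 3−δ, 2, 1`) along nested dyadic sequences (arXiv:1012.5963, proof of Prop. 5.6 and the
appendix *Dyadic sequences*), and Moschidis isolates it as the inductive scheme of §9.7, whose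
hypothesis/conclusion reads (inductive hypothesis at the start of §9.7, `T` Killing, `F = 0`)
`𝓔^{(p,q,m)}(τ₂) + ∫_{τ₂}^{τ₃} 𝓔^{(p−1,q,m)} ≲ (τ₂ − τ₁)^{−(2q−p)} 𝓔^{(2q,q,m + c·k)}(τ₁)`:
**level `p` of a hierarchy of length `L = 2q` decays like `τ^{-(L−p)}`, at the cost of `c·k`
derivatives, `k` being the loss in the integrated local energy decay statement** (Lemma 9.6 is
the corresponding statement along a dyadic sequence).

This file proves that scheme as a theorem about an arbitrary doubly indexed family
`a : ℕ → ℕ → ℝ → ℝ≥0∞`, `a p m τ` = "the level-`p` quantity of differentiability order `m` at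
time `τ`" (`p ≤ L`), subject to, for `τ₀ ≤ s ≤ t` (`τ₀ ≥ 1`) and a constant `C`:
* (mono) `a p m t ≤ C Σ_{i≤p} a i m s` — the boundary terms of the level-`p` estimate between
  the leaves `Σ_s`, `Σ_t` (energy boundedness for `p = 0`), the lower levels on the right being
  the cut-off errors of the `r^p` currents (controlled by the *lossless* integrated decay
  estimate away from trapping, i.e. by the energy, level `0`);
* (bulk) `∫_{[s,2s]} a (p−1) m ≤ C Σ_{i≤p} a i (m+k) s` (`1 ≤ p ≤ L`) — the bulk term of the
  level-`p` estimate, **losing `k` derivatives** (on black-hole exteriors only the step `p = 1`,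
  whose bulk term contains the local energy near trapping, actually loses; the hypothesis allows
  the loss everywhere);
* (data) `a p m τ₀ ≤ D m`, `D` non-decreasing in `m`.
Conclusion (`decay_of_hierarchy`): there are `K = K(L, k, C)` and `N = N(L, k, C)` such that
`a p m τ ≤ K · D(m + L k) · τ^{-(L−p)}` for `τ ≥ 2^N τ₀`; for `τ₀ = 1` and all `τ ≥ 1`
(`decay_of_hierarchy_one`, `decay_of_hierarchy_one_rpow`), without the order index when
nothing is lost (`decay_of_hierarchy_sameOrder`), and with external error terms already decaying
at the target rate of their level (`decay_of_hierarchy_one_ext`). In particular (`L = 4`, `p = 0`): the energy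
of `Tφ` decays like `τ⁻⁴` times an initial energy of order `4k` higher — the analytic core of the
second estimate of DRSR Cor. 3.1 and of hypotheses (D2), (D4) of
`KerrPointwiseDecayHierarchy.lean` / `KerrDerivativeDecayHierarchy.lean`.

## The proof

Exactly the printed induction, with the pigeonhole principle replaced (as in `DyadicDecay.lean`)
by integrating the (mono) inequality over `u ∈ [s, 2s]`, so that **no measurability is needed**:
only "a function plus a constant" is ever split under an integral (`improve_step`).
`Claim(n)`: `a p m τ ≲ D(m + n k) τ^{-min(n, L−p)}` (`decay_of_hierarchy_round`). `Claim(0)` is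
boundedness. `Claim(n) ⟹ Claim(n+1)` by an inner induction on the level `p` — level `0` first,
because its (mono) inequality has no lower level on the right; then level `p` uses the bulk
bound of level `p + 1` from `Claim(n)` (exponent `min(n, L−p−1)`, one power of `τ` gained by the
time average) and the *already improved* levels `< p` for the feedback terms (exponent
`min(n+1, L−i) ≥ min(n+1, L−p)`), `level_improve`. Since `τ₀ ≥ 1`, `τ^{-y} ≤ τ^{-x}` for
`x ≤ y`, which is all the bookkeeping uses; the constants are existential but depend on
`(L, k, C)` only (they are chosen before the family `a`, the data bound `D` and `τ₀`).

## How the Kerr application reads (documentation only; nothing below is used in this file)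

For (31)/(D2)–(D4) on subextremal Kerr (DRSR §3.3 with Moschidis §9): label orders by the total
number of derivatives, `a 0 m = 𝔈_m(τ) = Σ_{i≤m} ∫_{Σ̃_τ} J^N[N^i ψ] n` (DRSR (28): lossless
(mono)), `a 1 m`, `a 2 m` = the `p = 1, 2` weighted far energies of `T^iψ`, `i ≤ m` (Moschidis
Thm. 5.1; cut-off errors `≲` far, lossless ILED `≲ a 0 m`), `a 3 m`, `a 4 m` = the `k = 2`,
`p = 3, 4` norms of `T^iψ`, `i ≤ m − 1` (Thm. 6.1), the conversion at `p = 2` being the wave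
equation; the only loss is DRSR (25) near trapping in the bulk of level `1`
(`∫_{[s,2s]} 𝔈_m ≤ C (a 1 m s + 𝔈_{m+1}(s))`, `k = 1`). `decay_of_hierarchy_one` with `L = 4`
then gives `𝔈_m(τ) ≲ 𝔈_{m+4}(1) τ⁻⁴` — in particular the local `J^N[Nψ]`-energy and, by the
elliptic estimate (29) and the Sobolev/Agmon layer already in the library, (31).

## References

* G. Moschidis, *The `r^p`-weighted energy method of Dafermos and Rodnianski in general
  asymptotically flat spacetimes and applications*, Ann. PDE 2 (2016), arXiv:1509.08489: Thm. 6.1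
  (`2k−2 < p ≤ 2k`), §9.4 (sketch), Lemma 9.6, §9.7 (inductive hypothesis and inductive step),
  Thm. 9.1 (key `Moschidis2016`).
* V. Schlue, *Decay of linear waves on higher-dimensional Schwarzschild black holes*, Analysis &
  PDE 6 (2013) 515–600, arXiv:1012.5963: Prop. 5.6 (improved interior first order energy decay,
  `τ^{-(4−2δ)}`, "a hierarchy of four steps") and the appendix *Dyadic sequences* (key
  `Schlue2013`).
* M. Dafermos, I. Rodnianski, *A new physical-space approach to decay for the wave equation*,
  XVIth ICMP (2010), arXiv:0910.4957, §3–§4 (the dyadic iteration) (key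
  `DafermosRodnianski2010ICMP`).
* M. Dafermos, I. Rodnianski, Y. Shlapentokh-Rothman, arXiv:1402.7034 = Ann. of Math. 183 (2016),
  §3.3, Cor. 3.1 (key `DafermosRodnianskiShlapentokhrothman2014`).
-/

noncomputable section

open MeasureTheory Set Finset
open scoped ENNReal NNReal

namespace Literature.Geometry.Lorentzian

namespace DafermosRodnianski

/-! ### The decay factor `ENNReal.ofReal τ⁻¹` -/

/-- `τ⁻¹ ≤ 1` for `τ ≥ 1`, in `ℝ≥0∞`. [folklore] -/
theorem ofReal_inv_le_one {τ : ℝ} (hτ : 1 ≤ τ) : ENNReal.ofReal τ⁻¹ ≤ 1 := by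
  rw [← ENNReal.ofReal_one]
  exact ENNReal.ofReal_le_ofReal (inv_le_one_of_one_le₀ hτ)

/-- Powers of `τ⁻¹` decrease with the exponent when `τ ≥ 1`. [folklore] -/
theorem ofReal_inv_pow_anti {τ : ℝ} (hτ : 1 ≤ τ) {x y : ℕ} (hxy : x ≤ y) :
    ENNReal.ofReal τ⁻¹ ^ y ≤ ENNReal.ofReal τ⁻¹ ^ x :=
  pow_le_pow_of_le_one zero_le (ofReal_inv_le_one hτ) hxy

/-- `u⁻¹ ≤ s⁻¹` for `0 < s ≤ u`, in `ℝ≥0∞`. [folklore] -/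
theorem ofReal_inv_anti {s u : ℝ} (hs : 0 < s) (hsu : s ≤ u) :
    ENNReal.ofReal u⁻¹ ≤ ENNReal.ofReal s⁻¹ :=
  ENNReal.ofReal_le_ofReal (inv_anti₀ hs hsu)

/-- `s⁻¹ = 2 (2s)⁻¹` in `ℝ≥0∞`. [folklore] -/
theorem ofReal_inv_eq_two_mul {s : ℝ} (hs : s ≠ 0) :
    ENNReal.ofReal s⁻¹ = 2 * ENNReal.ofReal (2 * s)⁻¹ := by
  rw [show s⁻¹ = 2 * (2 * s)⁻¹ by field_simp, ENNReal.ofReal_mul zero_le_two,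
    ENNReal.ofReal_ofNat]

/-- `(τ/2)^{-x} ≤ 2^L τ^{-x}` for `x ≤ L`, in `ℝ≥0∞`. [folklore] -/
theorem ofReal_inv_half_pow_le {τ : ℝ} (hτ : τ ≠ 0) {x L : ℕ} (hxL : x ≤ L) :
    ENNReal.ofReal (τ / 2)⁻¹ ^ x ≤ 2 ^ L * ENNReal.ofReal τ⁻¹ ^ x := by
  have h2 : ENNReal.ofReal (τ / 2)⁻¹ = 2 * ENNReal.ofReal τ⁻¹ := by
    rw [ofReal_inv_eq_two_mul (div_ne_zero hτ two_ne_zero), show 2 * (τ / 2) = τ by ring]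
  rw [h2, mul_pow]
  exact mul_le_mul' (pow_le_pow_right₀ one_le_two hxL) le_rfl

/-- `(τ⁻¹)^j = τ^{-j}` as real powers, in `ℝ≥0∞` (`τ > 0`). [folklore] -/
theorem ofReal_inv_pow_eq_ofReal_rpow {τ : ℝ} (hτ : 0 < τ) (j : ℕ) :
    ENNReal.ofReal τ⁻¹ ^ j = ENNReal.ofReal (τ ^ (-(j : ℝ))) := by
  rw [← ENNReal.ofReal_pow (inv_nonneg.mpr hτ.le), Real.rpow_neg hτ.le, Real.rpow_natCast,
    inv_pow]

/-! ### One improvement step -/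

/-- **One improvement step** (Dafermos–Rodnianski, arXiv:0910.4957, §4, the passage
"(biv) + (EB) ⟹ decay" run with a decaying right-hand side; Moschidis, arXiv:1509.08489, Lemma 9.6,
one step of the induction on `l`). Let `f` ("level `p`") and `F` ("the levels below `p`") satisfy
the boundary inequality `f(2s) ≤ C (f u + F u)` for `u ∈ [s, 2s]`, let the time average of `f`
over `[s, 2s]` be `≤ B₁ s^{-x}` (the bulk bound coming from level `p + 1`) and let the feedback be
already known to decay one power better, `F u ≤ B₂ u^{-(x+1)}`. Then `f(2s) ≤ C (B₁ + B₂) s^{-(x+1)}`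
for `s ≥ S` (`S ≥ 1`). No measurability is assumed: the boundary inequality is integrated over
`u ∈ [s, 2s]` with the feedback replaced by its (constant) bound. [cite: DafermosRodnianski2010ICMP, §4 p. 9; Moschidis2016, Lemma 9.6] -/
theorem improve_step {f F : ℝ → ℝ≥0∞} {C : ℝ≥0} {B₁ B₂ : ℝ≥0∞} {S : ℝ} {x : ℕ} (hS : 1 ≤ S)
    (hmono : ∀ s u, S ≤ s → u ∈ Icc s (2 * s) → f (2 * s) ≤ C * (f u + F u))
    (hbulk : ∀ s, S ≤ s → ∫⁻ u in Icc s (2 * s), f u ≤ B₁ * ENNReal.ofReal s⁻¹ ^ x)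
    (hF : ∀ u, S ≤ u → F u ≤ B₂ * ENNReal.ofReal u⁻¹ ^ (x + 1)) :
    ∀ s, S ≤ s → f (2 * s) ≤ C * (B₁ + B₂) * ENNReal.ofReal s⁻¹ ^ (x + 1) := by
  intro s hs
  have hspos : 0 < s := by linarith
  -- the feedback is at most the constant `E` on `[s, 2s]`
  set E : ℝ≥0∞ := C * (B₂ * ENNReal.ofReal s⁻¹ ^ (x + 1)) with hE
  have hpt : ∀ u ∈ Icc s (2 * s), f (2 * s) ≤ C * f u + E := by
    intro u hu
    have hFu : F u ≤ B₂ * ENNReal.ofReal s⁻¹ ^ (x + 1) :=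
      calc F u ≤ B₂ * ENNReal.ofReal u⁻¹ ^ (x + 1) := hF u (hs.trans hu.1)
        _ ≤ B₂ * ENNReal.ofReal s⁻¹ ^ (x + 1) :=
            mul_le_mul' le_rfl (pow_le_pow_left' (ofReal_inv_anti hspos hu.1) _)
    calc f (2 * s) ≤ C * (f u + F u) := hmono s u hs hu
      _ = C * f u + C * F u := by ring
      _ ≤ C * f u + E := add_le_add le_rfl (mul_le_mul' le_rfl hFu)
  have hint : ENNReal.ofReal s * f (2 * s) ≤
      C * (B₁ * ENNReal.ofReal s⁻¹ ^ x) + E * ENNReal.ofReal s := by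
    calc ENNReal.ofReal s * f (2 * s) = ∫⁻ _ in Icc s (2 * s), f (2 * s) := by
          rw [setLIntegral_const, Real.volume_Icc, show 2 * s - s = s by ring, mul_comm]
      _ ≤ ∫⁻ u in Icc s (2 * s), (C * f u + E) := setLIntegral_mono' measurableSet_Icc hpt
      _ = C * (∫⁻ u in Icc s (2 * s), f u) + E * ENNReal.ofReal s := by
          rw [lintegral_add_right' _ aemeasurable_const, lintegral_const_mul' _ _ ENNReal.coe_ne_top,
            setLIntegral_const, Real.volume_Icc, show 2 * s - s = s by ring]
      _ ≤ C * (B₁ * ENNReal.ofReal s⁻¹ ^ x) + E * ENNReal.ofReal s :=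
          add_le_add (mul_le_mul' le_rfl (hbulk s hs)) le_rfl
  have h := le_mul_ofReal_inv_of_ofReal_mul_le hspos hint
  have h1 : ENNReal.ofReal s * ENNReal.ofReal s⁻¹ = 1 := by
    rw [← ENNReal.ofReal_mul hspos.le, mul_inv_cancel₀ hspos.ne', ENNReal.ofReal_one]
  calc f (2 * s)
      ≤ (C * (B₁ * ENNReal.ofReal s⁻¹ ^ x) + E * ENNReal.ofReal s) * ENNReal.ofReal s⁻¹ := h
    _ = C * B₁ * (ENNReal.ofReal s⁻¹ ^ x * ENNReal.ofReal s⁻¹) +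
          E * (ENNReal.ofReal s * ENNReal.ofReal s⁻¹) := by ring
    _ = C * B₁ * ENNReal.ofReal s⁻¹ ^ (x + 1) + E := by rw [h1, mul_one, pow_succ]
    _ = C * (B₁ + B₂) * ENNReal.ofReal s⁻¹ ^ (x + 1) := by rw [hE]; ring

/-! ### Improving one level, given the previous round and the lower levels -/

/-- **The inductive step at one level** (Moschidis, arXiv:1509.08489, §9.7, proof of the inductive
step; Dafermos–Rodnianski, arXiv:0910.4957, §4). Fix a level `p < L`. Suppose that in the previous
round every level `i ≤ p + 1` is known to decay like `τ^{-min(n, L−i)}` with `D(m + nk)`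
(`hround`), and that in the present round the levels `i < p` are already known to decay like
`τ^{-min(n+1, L−i)}` with `D(m + (n+1)k)` (`hlow`). Then the bulk bound of level `p + 1` (losing
`k` orders) and the boundary inequality of level `p` give, through `improve_step`, the decay
`τ^{-min(n+1, L−p)}` of level `p` with `D(m + (n+1)k)`, from twice the later of the two
thresholds on. [cite: Moschidis2016, §9.7; DafermosRodnianski2010ICMP, §4 p. 9] -/
theorem level_improve {L k n p N Nf : ℕ} {C K Kf : ℝ≥0} {a : ℕ → ℕ → ℝ → ℝ≥0∞}
    {D : ℕ → ℝ≥0∞} {τ₀ : ℝ} (hτ₀ : 1 ≤ τ₀) (hpL : p < L)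
    (hmono : ∀ m s t, τ₀ ≤ s → s ≤ t → a p m t ≤ C * ∑ i ∈ range (p + 1), a i m s)
    (hbulk : ∀ m s, τ₀ ≤ s →
      ∫⁻ u in Icc s (2 * s), a p m u ≤ C * ∑ i ∈ range (p + 1 + 1), a i (m + k) s)
    (hround : ∀ i, i ≤ p + 1 → ∀ m τ, (2 : ℝ) ^ N * τ₀ ≤ τ →
      a i m τ ≤ K * D (m + n * k) * ENNReal.ofReal τ⁻¹ ^ min n (L - i))
    (hlow : ∀ i, i < p → ∀ m τ, (2 : ℝ) ^ Nf * τ₀ ≤ τ →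
      a i m τ ≤ Kf * D (m + (n + 1) * k) * ENNReal.ofReal τ⁻¹ ^ min (n + 1) (L - i)) :
    ∀ m τ, (2 : ℝ) ^ (max N Nf + 1) * τ₀ ≤ τ →
      a p m τ ≤ ((2 ^ L * C * (C * (L + 2) * K + L * Kf) : ℝ≥0) : ℝ≥0∞) * D (m + (n + 1) * k) *
        ENNReal.ofReal τ⁻¹ ^ min (n + 1) (L - p) := by
  intro m τ hτ
  -- the exponents
  set x : ℕ := min n (L - p - 1) with hxdef
  have hx : x + 1 = min (n + 1) (L - p) := by omega
  -- the common threshold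
  set S : ℝ := (2 : ℝ) ^ max N Nf * τ₀ with hSdef
  have hτ₀pos : 0 < τ₀ := by linarith
  have h2N : (2 : ℝ) ^ N ≤ 2 ^ max N Nf := pow_le_pow_right₀ one_le_two (le_max_left _ _)
  have h2Nf : (2 : ℝ) ^ Nf ≤ 2 ^ max N Nf := pow_le_pow_right₀ one_le_two (le_max_right _ _)
  have hS1 : 1 ≤ S := by
    have h1 : (1 : ℝ) ≤ 2 ^ max N Nf := one_le_pow₀ one_le_two
    calc (1 : ℝ) = 1 * 1 := by ring
      _ ≤ 2 ^ max N Nf * τ₀ := mul_le_mul h1 hτ₀ zero_le_one (by positivity)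
  have hSτ₀ : τ₀ ≤ S := by
    calc τ₀ = 1 * τ₀ := by ring
      _ ≤ 2 ^ max N Nf * τ₀ := mul_le_mul_of_nonneg_right (one_le_pow₀ one_le_two) hτ₀pos.le
  have hSN : ∀ s, S ≤ s → (2 : ℝ) ^ N * τ₀ ≤ s := fun s hs ↦
    (mul_le_mul_of_nonneg_right h2N hτ₀pos.le).trans hs
  have hSNf : ∀ s, S ≤ s → (2 : ℝ) ^ Nf * τ₀ ≤ s := fun s hs ↦
    (mul_le_mul_of_nonneg_right h2Nf hτ₀pos.le).trans hs
  -- the data factor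
  set Dm : ℝ≥0∞ := D (m + (n + 1) * k) with hDm
  have hmk : m + k + n * k = m + (n + 1) * k := by ring
  -- the three hypotheses of `improve_step` for `f = a p m`, `F = Σ_{i<p} a i m`
  have hmono' : ∀ s u, S ≤ s → u ∈ Icc s (2 * s) →
      a p m (2 * s) ≤ C * (a p m u + ∑ i ∈ range p, a i m u) := by
    intro s u hs hu
    have h := hmono m u (2 * s) (hSτ₀.trans (hs.trans hu.1)) hu.2
    rw [sum_range_succ, add_comm] at h
    exact h
  have hbulk' : ∀ s, S ≤ s →
      ∫⁻ u in Icc s (2 * s), a p m u ≤ (C * (L + 2) * K * Dm) * ENNReal.ofReal s⁻¹ ^ x := by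
    intro s hs
    have hs1 : 1 ≤ s := hS1.trans hs
    have hterm : ∀ i ∈ range (p + 1 + 1),
        a i (m + k) s ≤ K * Dm * ENNReal.ofReal s⁻¹ ^ x := by
      intro i hi
      have hi' : i ≤ p + 1 := Nat.lt_succ_iff.mp (mem_range.mp hi)
      calc a i (m + k) s ≤ K * D (m + k + n * k) * ENNReal.ofReal s⁻¹ ^ min n (L - i) :=
            hround i hi' (m + k) s (hSN s hs)
        _ ≤ K * Dm * ENNReal.ofReal s⁻¹ ^ x := by
            rw [hmk]
            exact mul_le_mul' le_rfl (ofReal_inv_pow_anti hs1 (by omega))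
    calc ∫⁻ u in Icc s (2 * s), a p m u ≤ C * ∑ i ∈ range (p + 1 + 1), a i (m + k) s :=
          hbulk m s (hSτ₀.trans hs)
      _ ≤ C * ∑ _i ∈ range (p + 1 + 1), K * Dm * ENNReal.ofReal s⁻¹ ^ x :=
          mul_le_mul' le_rfl (sum_le_sum hterm)
      _ = C * ((p + 1 + 1 : ℕ) * (K * Dm * ENNReal.ofReal s⁻¹ ^ x)) := by
          rw [sum_const, card_range, nsmul_eq_mul]
      _ ≤ C * ((L + 2 : ℕ) * (K * Dm * ENNReal.ofReal s⁻¹ ^ x)) := by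
          have hle : ((p + 1 + 1 : ℕ) : ℝ≥0∞) ≤ ((L + 2 : ℕ) : ℝ≥0∞) := by
            exact_mod_cast (by omega : p + 1 + 1 ≤ L + 2)
          exact mul_le_mul' le_rfl (mul_le_mul' hle le_rfl)
      _ = (C * (L + 2) * K * Dm) * ENNReal.ofReal s⁻¹ ^ x := by push_cast; ring
  have hF' : ∀ u, S ≤ u →
      ∑ i ∈ range p, a i m u ≤ (L * Kf * Dm) * ENNReal.ofReal u⁻¹ ^ (x + 1) := by
    intro u hu
    have hu1 : 1 ≤ u := hS1.trans hu
    have hterm : ∀ i ∈ range p, a i m u ≤ Kf * Dm * ENNReal.ofReal u⁻¹ ^ (x + 1) := by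
      intro i hi
      have hi' : i < p := mem_range.mp hi
      calc a i m u ≤ Kf * Dm * ENNReal.ofReal u⁻¹ ^ min (n + 1) (L - i) :=
            hlow i hi' m u (hSNf u hu)
        _ ≤ Kf * Dm * ENNReal.ofReal u⁻¹ ^ (x + 1) :=
            mul_le_mul' le_rfl (ofReal_inv_pow_anti hu1 (by omega))
    calc ∑ i ∈ range p, a i m u ≤ ∑ _i ∈ range p, Kf * Dm * ENNReal.ofReal u⁻¹ ^ (x + 1) :=
          sum_le_sum hterm
      _ = (p : ℕ) * (Kf * Dm * ENNReal.ofReal u⁻¹ ^ (x + 1)) := by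
          rw [sum_const, card_range, nsmul_eq_mul]
      _ ≤ (L : ℕ) * (Kf * Dm * ENNReal.ofReal u⁻¹ ^ (x + 1)) := by
          gcongr
      _ = (L * Kf * Dm) * ENNReal.ofReal u⁻¹ ^ (x + 1) := by ring
  -- the improvement step, at `s = τ / 2`
  have hstep := improve_step (f := a p m) (F := fun u ↦ ∑ i ∈ range p, a i m u) hS1 hmono'
    hbulk' hF'
  have hτS : S ≤ τ / 2 := by
    have : (2 : ℝ) ^ (max N Nf + 1) * τ₀ = 2 * S := by rw [pow_succ]; ring
    linarith
  have hτpos : 0 < τ := by linarith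
  have h := hstep (τ / 2) hτS
  rw [show 2 * (τ / 2) = τ by ring, hx] at h
  have hxL : min (n + 1) (L - p) ≤ L := (min_le_right _ _).trans (Nat.sub_le _ _)
  calc a p m τ ≤ C * (C * (L + 2) * K * Dm + L * Kf * Dm) *
        ENNReal.ofReal (τ / 2)⁻¹ ^ min (n + 1) (L - p) := h
    _ ≤ C * (C * (L + 2) * K * Dm + L * Kf * Dm) *
        (2 ^ L * ENNReal.ofReal τ⁻¹ ^ min (n + 1) (L - p)) :=
        mul_le_mul' le_rfl (ofReal_inv_half_pow_le hτpos.ne' hxL)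
    _ = ((2 ^ L * C * (C * (L + 2) * K + L * Kf) : ℝ≥0) : ℝ≥0∞) * Dm *
        ENNReal.ofReal τ⁻¹ ^ min (n + 1) (L - p) := by push_cast; ring

/-! ### The rounds of the induction -/

/-- **Round `n` of the induction** (Moschidis, arXiv:1509.08489, §9.7: the inductive scheme on
the length of the hierarchy already exploited; Schlue, arXiv:1012.5963, proof of Prop. 5.6;
Dafermos–Rodnianski, arXiv:0910.4957, §4). Under (mono), (bulk, losing `k` orders) and (data) — see the module
docstring — every level `p ≤ L` satisfies `a p m τ ≤ K · D(m + nk) · τ^{-min(n, L−p)}` for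
`τ ≥ 2^N τ₀`, with `K, N` depending only on `(L, k, C, n)`. [cite: Moschidis2016, §9.7 (inductive step), Lemma 9.6; Schlue2013, Prop. 5.6 (proof); DafermosRodnianski2010ICMP, §4 p. 9] -/
theorem decay_of_hierarchy_round (L k : ℕ) (C : ℝ≥0) (n : ℕ) :
    ∃ (K : ℝ≥0) (N : ℕ), ∀ (a : ℕ → ℕ → ℝ → ℝ≥0∞) (D : ℕ → ℝ≥0∞) (τ₀ : ℝ), 1 ≤ τ₀ →
      (∀ m m', m ≤ m' → D m ≤ D m') →
      (∀ p, p ≤ L → ∀ m s t, τ₀ ≤ s → s ≤ t → a p m t ≤ C * ∑ i ∈ range (p + 1), a i m s) →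
      (∀ p, 1 ≤ p → p ≤ L → ∀ m s, τ₀ ≤ s →
        ∫⁻ u in Icc s (2 * s), a (p - 1) m u ≤ C * ∑ i ∈ range (p + 1), a i (m + k) s) →
      (∀ p, p ≤ L → ∀ m, a p m τ₀ ≤ D m) →
      ∀ p, p ≤ L → ∀ m τ, (2 : ℝ) ^ N * τ₀ ≤ τ →
        a p m τ ≤ K * D (m + n * k) * ENNReal.ofReal τ⁻¹ ^ min n (L - p) := by
  -- boundedness of every level (used in every round): `a p m τ ≤ C (L+1) D m` for `τ ≥ τ₀`
  have hbdd : ∀ (a : ℕ → ℕ → ℝ → ℝ≥0∞) (D : ℕ → ℝ≥0∞) (τ₀ : ℝ),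
      (∀ p, p ≤ L → ∀ m s t, τ₀ ≤ s → s ≤ t → a p m t ≤ C * ∑ i ∈ range (p + 1), a i m s) →
      (∀ p, p ≤ L → ∀ m, a p m τ₀ ≤ D m) →
      ∀ p, p ≤ L → ∀ m τ, τ₀ ≤ τ → a p m τ ≤ ((C * (L + 1) : ℝ≥0) : ℝ≥0∞) * D m := by
    intro a D τ₀ hmono hdata p hpL m τ hτ
    calc a p m τ ≤ C * ∑ i ∈ range (p + 1), a i m τ₀ := hmono p hpL m τ₀ τ le_rfl hτ
      _ ≤ C * ∑ _i ∈ range (p + 1), D m := by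
          refine mul_le_mul' le_rfl (sum_le_sum fun i hi ↦ hdata i ?_ m)
          exact (Nat.lt_succ_iff.mp (mem_range.mp hi)).trans hpL
      _ = C * ((p + 1 : ℕ) * D m) := by rw [sum_const, card_range, nsmul_eq_mul]
      _ ≤ C * ((L + 1 : ℕ) * D m) := by gcongr
      _ = ((C * (L + 1) : ℝ≥0) : ℝ≥0∞) * D m := by push_cast; ring
  induction n with
  | zero =>
    refine ⟨C * (L + 1), 0, ?_⟩
    intro a D τ₀ hτ₀ hD hmono hbulk hdata p hpL m τ hτ
    have hτ' : τ₀ ≤ τ := by simpa using hτ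
    have h := hbdd a D τ₀ hmono hdata p hpL m τ hτ'
    simpa using h
  | succ n ih =>
    obtain ⟨K, N, hK⟩ := ih
    -- inner induction on the level: the levels `< p₀` in round `n + 1`
    have Q : ∀ p₀ : ℕ, ∃ (Kf : ℝ≥0) (Nf : ℕ), ∀ (a : ℕ → ℕ → ℝ → ℝ≥0∞) (D : ℕ → ℝ≥0∞)
        (τ₀ : ℝ), 1 ≤ τ₀ → (∀ m m', m ≤ m' → D m ≤ D m') →
        (∀ p, p ≤ L → ∀ m s t, τ₀ ≤ s → s ≤ t →
          a p m t ≤ C * ∑ i ∈ range (p + 1), a i m s) →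
        (∀ p, 1 ≤ p → p ≤ L → ∀ m s, τ₀ ≤ s →
          ∫⁻ u in Icc s (2 * s), a (p - 1) m u ≤ C * ∑ i ∈ range (p + 1), a i (m + k) s) →
        (∀ p, p ≤ L → ∀ m, a p m τ₀ ≤ D m) →
        ∀ p, p < p₀ → p ≤ L → ∀ m τ, (2 : ℝ) ^ Nf * τ₀ ≤ τ →
          a p m τ ≤ Kf * D (m + (n + 1) * k) * ENNReal.ofReal τ⁻¹ ^ min (n + 1) (L - p) := by
      intro p₀
      induction p₀ with
      | zero => exact ⟨0, 0, fun a D τ₀ _ _ _ _ _ p hp ↦ absurd hp (Nat.not_lt_zero p)⟩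
      | succ p₀ ihp =>
        obtain ⟨Kf, Nf, hKf⟩ := ihp
        refine ⟨Kf + C * (L + 1) + 2 ^ L * C * (C * (L + 2) * K + L * Kf), max N Nf + 1, ?_⟩
        intro a D τ₀ hτ₀ hD hmono hbulk hdata p hp hpL m τ hτ
        have hτ₀pos : 0 < τ₀ := by linarith
        -- the new threshold dominates the old ones
        have hNf : (2 : ℝ) ^ Nf * τ₀ ≤ τ :=
          (mul_le_mul_of_nonneg_right (pow_le_pow_right₀ one_le_two (by omega)) hτ₀pos.le).trans hτ
        have hτ₀τ : τ₀ ≤ τ := by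
          calc τ₀ = 1 * τ₀ := by ring
            _ ≤ 2 ^ (max N Nf + 1) * τ₀ :=
                mul_le_mul_of_nonneg_right (one_le_pow₀ one_le_two) hτ₀pos.le
            _ ≤ τ := hτ
        -- the constants are monotone
        have hK1 : ((Kf : ℝ≥0) : ℝ≥0∞) ≤
            ((Kf + C * (L + 1) + 2 ^ L * C * (C * (L + 2) * K + L * Kf) : ℝ≥0) : ℝ≥0∞) := by
          exact_mod_cast le_self_add.trans le_self_add
        have hK2 : ((C * (L + 1) : ℝ≥0) : ℝ≥0∞) ≤
            ((Kf + C * (L + 1) + 2 ^ L * C * (C * (L + 2) * K + L * Kf) : ℝ≥0) : ℝ≥0∞) := by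
          exact_mod_cast le_add_self.trans le_self_add
        have hK3 : ((2 ^ L * C * (C * (L + 2) * K + L * Kf) : ℝ≥0) : ℝ≥0∞) ≤
            ((Kf + C * (L + 1) + 2 ^ L * C * (C * (L + 2) * K + L * Kf) : ℝ≥0) : ℝ≥0∞) := by
          exact_mod_cast le_add_self
        rcases Nat.lt_succ_iff_lt_or_eq.mp hp with hlt | rfl
        · -- a level already treated in this round
          calc a p m τ ≤ Kf * D (m + (n + 1) * k) * ENNReal.ofReal τ⁻¹ ^ min (n + 1) (L - p) :=
                hKf a D τ₀ hτ₀ hD hmono hbulk hdata p hlt hpL m τ hNf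
            _ ≤ _ := mul_le_mul' (mul_le_mul' hK1 le_rfl) le_rfl
        · rcases lt_or_eq_of_le hpL with hlt | rfl
          · -- a level `p < L`: improve it
            have h := level_improve (L := L) (k := k) (n := n) (p := p) (N := N) (Nf := Nf)
              (C := C) (K := K) (Kf := Kf) (a := a) (D := D) hτ₀ hlt (hmono p hpL)
              (fun m s hs ↦ by simpa using hbulk (p + 1) (by omega) (by omega) m s hs)
              (fun i hi m τ hτ ↦ hK a D τ₀ hτ₀ hD hmono hbulk hdata i (by omega) m τ hτ)
              (fun i hi m τ hτ ↦ hKf a D τ₀ hτ₀ hD hmono hbulk hdata i hi (by omega) m τ hτ)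
              m τ hτ
            exact h.trans (mul_le_mul' (mul_le_mul' hK3 le_rfl) le_rfl)
          · -- the top level `p = L`: boundedness
            have h := hbdd a D τ₀ hmono hdata p le_rfl m τ hτ₀τ
            have hDm : D m ≤ D (m + (n + 1) * k) := hD m _ (Nat.le_add_right _ _)
            calc a p m τ ≤ ((C * (p + 1) : ℝ≥0) : ℝ≥0∞) * D m := h
              _ ≤ ((Kf + C * (p + 1) + 2 ^ p * C * (C * (p + 2) * K + p * Kf) : ℝ≥0) : ℝ≥0∞) *
                    D (m + (n + 1) * k) := mul_le_mul' hK2 hDm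
              _ = _ := by simp
    obtain ⟨K', N', hK'⟩ := Q (L + 1)
    exact ⟨K', N', fun a D τ₀ hτ₀ hD hmono hbulk hdata p hpL m τ hτ ↦
      hK' a D τ₀ hτ₀ hD hmono hbulk hdata p (Nat.lt_succ_of_le hpL) hpL m τ hτ⟩

/-! ### The theorem -/

/-- **The `r^p` hierarchy of length `L` with loss of `k` derivatives gives `τ^{-(L−p)}` decay of
level `p`** (Moschidis, arXiv:1509.08489, §9.7, inductive scheme: `𝓔^{(p,q,m)}(τ₂) +
∫_{τ₂}^{τ₃} 𝓔^{(p−1,q,m)} ≲ (τ₂ − τ₁)^{−2q+p} 𝓔^{(2q,q,m+c k)}(τ₁)`, here with `L = 2q`, `T`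
Killing, `F = 0`; Schlue, arXiv:1012.5963, Prop. 5.6, "a hierarchy of four steps";
Dafermos–Rodnianski, arXiv:0910.4957, §4). Let
`a : ℕ → ℕ → ℝ → ℝ≥0∞` satisfy, for `1 ≤ τ₀ ≤ s ≤ t` and all orders `m`: (mono) `a p m t ≤
C Σ_{i≤p} a i m s` (`p ≤ L`); (bulk) `∫_{[s,2s]} a (p−1) m ≤ C Σ_{i≤p} a i (m+k) s` (`1 ≤ p ≤ L`);
(data) `a p m τ₀ ≤ D m` with `D` non-decreasing. Then there are `K, N`, depending only on
`(L, k, C)`, such that `a p m τ ≤ K · D(m + Lk) · (τ⁻¹)^{L−p}` for all `p ≤ L`, `m`, and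
`τ ≥ 2^N τ₀`. [cite: Moschidis2016, §9.7 (inductive step), Lemma 9.6, Thm. 9.1; Schlue2013, Prop. 5.6 (proof), App. (dyadic sequences); DafermosRodnianski2010ICMP, §4 p. 9] -/
theorem decay_of_hierarchy (L k : ℕ) (C : ℝ≥0) :
    ∃ (K : ℝ≥0) (N : ℕ), ∀ (a : ℕ → ℕ → ℝ → ℝ≥0∞) (D : ℕ → ℝ≥0∞) (τ₀ : ℝ), 1 ≤ τ₀ →
      (∀ m m', m ≤ m' → D m ≤ D m') →
      (∀ p, p ≤ L → ∀ m s t, τ₀ ≤ s → s ≤ t → a p m t ≤ C * ∑ i ∈ range (p + 1), a i m s) →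
      (∀ p, 1 ≤ p → p ≤ L → ∀ m s, τ₀ ≤ s →
        ∫⁻ u in Icc s (2 * s), a (p - 1) m u ≤ C * ∑ i ∈ range (p + 1), a i (m + k) s) →
      (∀ p, p ≤ L → ∀ m, a p m τ₀ ≤ D m) →
      ∀ p, p ≤ L → ∀ m τ, (2 : ℝ) ^ N * τ₀ ≤ τ →
        a p m τ ≤ K * D (m + L * k) * ENNReal.ofReal τ⁻¹ ^ (L - p) := by
  obtain ⟨K, N, hK⟩ := decay_of_hierarchy_round L k C L
  refine ⟨K, N, fun a D τ₀ hτ₀ hD hmono hbulk hdata p hpL m τ hτ ↦ ?_⟩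
  have h := hK a D τ₀ hτ₀ hD hmono hbulk hdata p hpL m τ hτ
  rwa [min_eq_right (Nat.sub_le L p)] at h

/-- **All times `τ ≥ 1`** (`τ₀ = 1`): under (mono), (bulk), (data at `τ₀ = 1`) there is
`K = K(L, k, C)` with `a p m τ ≤ K · D(m + Lk) · (τ⁻¹)^{L−p}` for every `p ≤ L`, `m` and `τ ≥ 1`
(on `[1, 2^N]` boundedness alone gives the bound, `1 ≤ 2^{NL} (τ⁻¹)^{L−p}` there).
[cite: Moschidis2016, §9.7 (inductive step), Thm. 9.1; Schlue2013, Prop. 5.6 (proof); DafermosRodnianski2010ICMP, §4 p. 9] -/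
theorem decay_of_hierarchy_one (L k : ℕ) (C : ℝ≥0) :
    ∃ K : ℝ≥0, ∀ (a : ℕ → ℕ → ℝ → ℝ≥0∞) (D : ℕ → ℝ≥0∞),
      (∀ m m', m ≤ m' → D m ≤ D m') →
      (∀ p, p ≤ L → ∀ m s t, 1 ≤ s → s ≤ t → a p m t ≤ C * ∑ i ∈ range (p + 1), a i m s) →
      (∀ p, 1 ≤ p → p ≤ L → ∀ m s, 1 ≤ s →
        ∫⁻ u in Icc s (2 * s), a (p - 1) m u ≤ C * ∑ i ∈ range (p + 1), a i (m + k) s) →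
      (∀ p, p ≤ L → ∀ m, a p m 1 ≤ D m) →
      ∀ p, p ≤ L → ∀ m τ, 1 ≤ τ →
        a p m τ ≤ K * D (m + L * k) * ENNReal.ofReal τ⁻¹ ^ (L - p) := by
  obtain ⟨K, N, hK⟩ := decay_of_hierarchy L k C
  refine ⟨K + 2 ^ (N * L) * (C * (L + 1)), fun a D hD hmono hbulk hdata p hpL m τ hτ ↦ ?_⟩
  have hτpos : 0 < τ := by linarith
  by_cases hN : (2 : ℝ) ^ N * 1 ≤ τ
  · calc a p m τ ≤ K * D (m + L * k) * ENNReal.ofReal τ⁻¹ ^ (L - p) :=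
          hK a D 1 le_rfl hD hmono hbulk hdata p hpL m τ hN
      _ ≤ ((K + 2 ^ (N * L) * (C * (L + 1)) : ℝ≥0) : ℝ≥0∞) * D (m + L * k) *
            ENNReal.ofReal τ⁻¹ ^ (L - p) := by
          gcongr
          exact_mod_cast le_self_add
  · have hτN : τ ≤ 2 ^ N := by linarith [not_le.mp hN]
    -- boundedness
    have hb : a p m τ ≤ C * (L + 1) * D (m + L * k) := by
      calc a p m τ ≤ C * ∑ i ∈ range (p + 1), a i m 1 := hmono p hpL m 1 τ le_rfl hτ
        _ ≤ C * ∑ _i ∈ range (p + 1), D (m + L * k) := by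
            refine mul_le_mul' le_rfl (sum_le_sum fun i hi ↦ (hdata i ?_ m).trans (hD _ _ ?_))
            · exact (Nat.lt_succ_iff.mp (mem_range.mp hi)).trans hpL
            · exact Nat.le_add_right _ _
        _ = C * ((p + 1 : ℕ) * D (m + L * k)) := by rw [sum_const, card_range, nsmul_eq_mul]
        _ ≤ C * ((L + 1 : ℕ) * D (m + L * k)) := by gcongr
        _ = C * (L + 1) * D (m + L * k) := by push_cast; ring
    -- `1 ≤ 2^{NL} (τ⁻¹)^{L-p}` on `[1, 2^N]`
    have hlow : (1 : ℝ≥0∞) ≤ 2 ^ (N * L) * ENNReal.ofReal τ⁻¹ ^ (L - p) := by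
      have h2 : ENNReal.ofReal ((2 : ℝ) ^ N)⁻¹ ≤ ENNReal.ofReal τ⁻¹ :=
        ENNReal.ofReal_le_ofReal (inv_anti₀ hτpos hτN)
      have h3 : ENNReal.ofReal ((2 : ℝ) ^ N)⁻¹ = (2 ^ N)⁻¹ := by
        rw [ENNReal.ofReal_inv_of_pos (by positivity), ENNReal.ofReal_pow zero_le_two,
          ENNReal.ofReal_ofNat]
      have h4 : ((2 : ℝ≥0∞) ^ N)⁻¹ ^ L ≤ ENNReal.ofReal τ⁻¹ ^ (L - p) :=
        calc ((2 : ℝ≥0∞) ^ N)⁻¹ ^ L ≤ ((2 : ℝ≥0∞) ^ N)⁻¹ ^ (L - p) :=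
              pow_le_pow_of_le_one zero_le
                (ENNReal.inv_le_one.mpr (one_le_pow₀ one_le_two)) (Nat.sub_le L p)
          _ ≤ ENNReal.ofReal τ⁻¹ ^ (L - p) := by rw [← h3]; exact pow_le_pow_left' h2 _
      have h5 : (2 : ℝ≥0∞) ^ (N * L) * ((2 : ℝ≥0∞) ^ N)⁻¹ ^ L = 1 := by
        rw [pow_mul, ← mul_pow, ENNReal.mul_inv_cancel (pow_ne_zero _ two_ne_zero)
          (ENNReal.pow_ne_top ENNReal.ofNat_ne_top), one_pow]
      calc (1 : ℝ≥0∞) = 2 ^ (N * L) * ((2 : ℝ≥0∞) ^ N)⁻¹ ^ L := h5.symm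
        _ ≤ 2 ^ (N * L) * ENNReal.ofReal τ⁻¹ ^ (L - p) := mul_le_mul' le_rfl h4
    calc a p m τ ≤ C * (L + 1) * D (m + L * k) * 1 := by rw [mul_one]; exact hb
      _ ≤ C * (L + 1) * D (m + L * k) * (2 ^ (N * L) * ENNReal.ofReal τ⁻¹ ^ (L - p)) :=
          mul_le_mul' le_rfl hlow
      _ = ((2 ^ (N * L) * (C * (L + 1)) : ℝ≥0) : ℝ≥0∞) * D (m + L * k) *
            ENNReal.ofReal τ⁻¹ ^ (L - p) := by push_cast; ring
      _ ≤ ((K + 2 ^ (N * L) * (C * (L + 1)) : ℝ≥0) : ℝ≥0∞) * D (m + L * k) *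
            ENNReal.ofReal τ⁻¹ ^ (L - p) := by
          gcongr
          exact_mod_cast le_add_self

/-- The same with the decay factor written as a real power `τ^{-(L−p)}`, matching
`DyadicDecay.lean`. [cite: Moschidis2016, §9.7 (inductive step), Thm. 9.1; Schlue2013, Prop. 5.6 (proof); DafermosRodnianski2010ICMP, §4 p. 9] -/
theorem decay_of_hierarchy_one_rpow (L k : ℕ) (C : ℝ≥0) :
    ∃ K : ℝ≥0, ∀ (a : ℕ → ℕ → ℝ → ℝ≥0∞) (D : ℕ → ℝ≥0∞),
      (∀ m m', m ≤ m' → D m ≤ D m') →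
      (∀ p, p ≤ L → ∀ m s t, 1 ≤ s → s ≤ t → a p m t ≤ C * ∑ i ∈ range (p + 1), a i m s) →
      (∀ p, 1 ≤ p → p ≤ L → ∀ m s, 1 ≤ s →
        ∫⁻ u in Icc s (2 * s), a (p - 1) m u ≤ C * ∑ i ∈ range (p + 1), a i (m + k) s) →
      (∀ p, p ≤ L → ∀ m, a p m 1 ≤ D m) →
      ∀ p, p ≤ L → ∀ m τ, 1 ≤ τ →
        a p m τ ≤ K * D (m + L * k) * ENNReal.ofReal (τ ^ (-((L - p : ℕ) : ℝ))) := by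
  obtain ⟨K, hK⟩ := decay_of_hierarchy_one L k C
  refine ⟨K, fun a D hD hmono hbulk hdata p hpL m τ hτ ↦ ?_⟩
  rw [← ofReal_inv_pow_eq_ofReal_rpow (by linarith) (L - p)]
  exact hK a D hD hmono hbulk hdata p hpL m τ hτ

/-- **The lossless hierarchy of length `L`, without the order index** (e.g. Minkowski space, or
any hierarchy whose error terms are controlled at the same order): `b : ℕ → ℝ → ℝ≥0∞` with
(mono) `b p t ≤ C Σ_{i≤p} b i s`, (bulk) `∫_{[s,2s]} b (p−1) ≤ C Σ_{i≤p} b i s` (`1 ≤ s ≤ t`) and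
`b p 1 ≤ D₀` (`p ≤ L`) satisfies `b p τ ≤ K D₀ (τ⁻¹)^{L−p}` for `τ ≥ 1`, `K = K(L, C)`; for `L = 2`
this is the `τ⁻²` statement of Dafermos–Rodnianski (arXiv:0910.4957, §3 (finalest)), for
`L = 4`, `p = 0` the `τ⁻⁴` decay of the energy of `Tφ` (Schlue; Moschidis Thm. 9.1, `q = 2`).
[cite: Moschidis2016, §9.7, Thm. 9.1; Schlue2013, Prop. 5.6 (proof); DafermosRodnianski2010ICMP, §3 (finalest), §4 p. 9] -/
theorem decay_of_hierarchy_sameOrder (L : ℕ) (C : ℝ≥0) :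
    ∃ K : ℝ≥0, ∀ (b : ℕ → ℝ → ℝ≥0∞) (D₀ : ℝ≥0∞),
      (∀ p, p ≤ L → ∀ s t, 1 ≤ s → s ≤ t → b p t ≤ C * ∑ i ∈ range (p + 1), b i s) →
      (∀ p, 1 ≤ p → p ≤ L → ∀ s, 1 ≤ s →
        ∫⁻ u in Icc s (2 * s), b (p - 1) u ≤ C * ∑ i ∈ range (p + 1), b i s) →
      (∀ p, p ≤ L → b p 1 ≤ D₀) →
      ∀ p, p ≤ L → ∀ τ, 1 ≤ τ → b p τ ≤ K * D₀ * ENNReal.ofReal τ⁻¹ ^ (L - p) := by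
  obtain ⟨K, hK⟩ := decay_of_hierarchy_one L 0 C
  refine ⟨K, fun b D₀ hmono hbulk hdata p hpL τ hτ ↦ ?_⟩
  exact hK (fun p _ τ ↦ b p τ) (fun _ ↦ D₀) (fun _ _ _ ↦ le_rfl)
    (fun p hp m s t hs hst ↦ hmono p hp s t hs hst) (fun p hp hpL m s hs ↦ hbulk p hp hpL s hs)
    (fun p hp _ ↦ hdata p hp) p hpL 0 τ hτ

/-! ### External error terms with the target decay -/

/-- Measurability of the model decay profile `u ↦ E (u⁻¹)^j`. [folklore] -/
theorem measurable_const_mul_ofReal_inv_pow (E : ℝ≥0∞) (j : ℕ) :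
    Measurable fun u : ℝ ↦ E * ENNReal.ofReal u⁻¹ ^ j :=
  ((measurable_inv.ennreal_ofReal).pow_const j).const_mul E

/-- The time average of the model profile: `∫_{[s,2s]} E (u⁻¹)^{j+1} du ≤ E (s⁻¹)^j` (`s > 0`).
[folklore] -/
theorem lintegral_const_mul_ofReal_inv_pow_le (E : ℝ≥0∞) (j : ℕ) {s : ℝ} (hs : 0 < s) :
    ∫⁻ u in Icc s (2 * s), E * ENNReal.ofReal u⁻¹ ^ (j + 1) ≤ E * ENNReal.ofReal s⁻¹ ^ j := by
  have hpt : ∀ u ∈ Icc s (2 * s),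
      E * ENNReal.ofReal u⁻¹ ^ (j + 1) ≤ E * ENNReal.ofReal s⁻¹ ^ (j + 1) := fun u hu ↦
    mul_le_mul' le_rfl (pow_le_pow_left' (ofReal_inv_anti hs hu.1) _)
  have h1 : ENNReal.ofReal s⁻¹ * ENNReal.ofReal s = 1 := by
    rw [← ENNReal.ofReal_mul (inv_nonneg.mpr hs.le), inv_mul_cancel₀ hs.ne', ENNReal.ofReal_one]
  calc ∫⁻ u in Icc s (2 * s), E * ENNReal.ofReal u⁻¹ ^ (j + 1)
      ≤ ∫⁻ _ in Icc s (2 * s), E * ENNReal.ofReal s⁻¹ ^ (j + 1) :=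
        setLIntegral_mono' measurableSet_Icc hpt
    _ = E * ENNReal.ofReal s⁻¹ ^ (j + 1) * ENNReal.ofReal s := by
        rw [setLIntegral_const, Real.volume_Icc, show 2 * s - s = s by ring, mul_comm]
    _ = E * ENNReal.ofReal s⁻¹ ^ j * (ENNReal.ofReal s⁻¹ * ENNReal.ofReal s) := by ring
    _ = E * ENNReal.ofReal s⁻¹ ^ j := by rw [h1, mul_one]

/-- **The hierarchy with external error terms decaying at the target rate** (the form in which
the iteration is run when earlier decay results are fed in, e.g. Schlue, arXiv:1012.5963, proof
of Prop. 5.6, where the first-order decay of Prop. 5.2 enters the four-step hierarchy for `Tφ`;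
Moschidis, arXiv:1509.08489, §9.7, the terms carrying negative powers of `τ` on the right-hand
sides of Lemma 9.6). If (mono) and (bulk) hold up to errors `e p m s` with
`e p m s ≤ E m · (s⁻¹)^{L−p}` (`E` non-decreasing) — i.e. the error allowed at level `p` already
has the decay that level `p` is to acquire — then the conclusion of `decay_of_hierarchy_one`
persists with data `D + E`: `a p m τ ≤ K · (D + E)(m + Lk) · (τ⁻¹)^{L−p}` for `τ ≥ 1`,
`K = K(L, k, C)`. Proof: the family `a p m τ + E m (τ⁻¹)^{L−p}` satisfies the error-free
hypotheses with constant `2C + 1`. [cite: Moschidis2016, §9.7, Lemma 9.6; Schlue2013, Prop. 5.6 (proof); DafermosRodnianski2010ICMP, §4 p. 9] -/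
theorem decay_of_hierarchy_one_ext (L k : ℕ) (C : ℝ≥0) :
    ∃ K : ℝ≥0, ∀ (a e : ℕ → ℕ → ℝ → ℝ≥0∞) (D E : ℕ → ℝ≥0∞),
      (∀ m m', m ≤ m' → D m ≤ D m') → (∀ m m', m ≤ m' → E m ≤ E m') →
      (∀ p, p ≤ L → ∀ m s t, 1 ≤ s → s ≤ t →
        a p m t ≤ C * (∑ i ∈ range (p + 1), a i m s + e p m s)) →
      (∀ p, 1 ≤ p → p ≤ L → ∀ m s, 1 ≤ s →
        ∫⁻ u in Icc s (2 * s), a (p - 1) m u ≤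
          C * (∑ i ∈ range (p + 1), a i (m + k) s + e p (m + k) s)) →
      (∀ p, p ≤ L → ∀ m s, 1 ≤ s → e p m s ≤ E m * ENNReal.ofReal s⁻¹ ^ (L - p)) →
      (∀ p, p ≤ L → ∀ m, a p m 1 ≤ D m) →
      ∀ p, p ≤ L → ∀ m τ, 1 ≤ τ →
        a p m τ ≤ K * (D (m + L * k) + E (m + L * k)) * ENNReal.ofReal τ⁻¹ ^ (L - p) := by
  obtain ⟨K, hK⟩ := decay_of_hierarchy_one L k (2 * C + 1)
  refine ⟨K, fun a e D E hD hE hmono hbulk he hdata p hpL m τ hτ ↦ ?_⟩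
  -- the augmented family
  set b : ℕ → ℕ → ℝ → ℝ≥0∞ := fun p m τ ↦ a p m τ + E m * ENNReal.ofReal τ⁻¹ ^ (L - p) with hb
  have hab : ∀ p m τ, a p m τ ≤ b p m τ := fun p m τ ↦ le_self_add
  have hEb : ∀ p m τ, E m * ENNReal.ofReal τ⁻¹ ^ (L - p) ≤ b p m τ := fun p m τ ↦ le_add_self
  have hsum : ∀ p m s, ∑ i ∈ range (p + 1), a i m s ≤ ∑ i ∈ range (p + 1), b i m s :=
    fun p m s ↦ sum_le_sum fun i _ ↦ hab i m s
  have htop : ∀ p m s, b p m s ≤ ∑ i ∈ range (p + 1), b i m s := fun p m s ↦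
    single_le_sum (f := fun i ↦ b i m s) (fun i _ ↦ zero_le) (self_mem_range_succ p)
  -- (mono) for `b` with constant `2C + 1`
  have hmono' : ∀ p, p ≤ L → ∀ m s t, 1 ≤ s → s ≤ t →
      b p m t ≤ ((2 * C + 1 : ℝ≥0) : ℝ≥0∞) * ∑ i ∈ range (p + 1), b i m s := by
    intro p hpL m s t hs hst
    have hspos : 0 < s := by linarith
    have h1 : a p m t ≤ C * ∑ i ∈ range (p + 1), b i m s + C * ∑ i ∈ range (p + 1), b i m s :=
      calc a p m t ≤ C * (∑ i ∈ range (p + 1), a i m s + e p m s) := hmono p hpL m s t hs hst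
        _ = C * ∑ i ∈ range (p + 1), a i m s + C * e p m s := by ring
        _ ≤ C * ∑ i ∈ range (p + 1), b i m s + C * ∑ i ∈ range (p + 1), b i m s :=
            add_le_add (mul_le_mul' le_rfl (hsum p m s))
              (mul_le_mul' le_rfl (((he p hpL m s hs).trans (hEb p m s)).trans (htop p m s)))
    have h2 : E m * ENNReal.ofReal t⁻¹ ^ (L - p) ≤ ∑ i ∈ range (p + 1), b i m s :=
      calc E m * ENNReal.ofReal t⁻¹ ^ (L - p) ≤ E m * ENNReal.ofReal s⁻¹ ^ (L - p) :=
            mul_le_mul' le_rfl (pow_le_pow_left' (ofReal_inv_anti hspos hst) _)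
        _ ≤ ∑ i ∈ range (p + 1), b i m s := (hEb p m s).trans (htop p m s)
    calc b p m t = a p m t + E m * ENNReal.ofReal t⁻¹ ^ (L - p) := rfl
      _ ≤ (C * ∑ i ∈ range (p + 1), b i m s + C * ∑ i ∈ range (p + 1), b i m s) +
            ∑ i ∈ range (p + 1), b i m s := add_le_add h1 h2
      _ = ((2 * C + 1 : ℝ≥0) : ℝ≥0∞) * ∑ i ∈ range (p + 1), b i m s := by push_cast; ring
  -- (bulk) for `b` with constant `2C + 1`
  have hbulk' : ∀ p, 1 ≤ p → p ≤ L → ∀ m s, 1 ≤ s →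
      ∫⁻ u in Icc s (2 * s), b (p - 1) m u ≤
        ((2 * C + 1 : ℝ≥0) : ℝ≥0∞) * ∑ i ∈ range (p + 1), b i (m + k) s := by
    intro p hp hpL m s hs
    have hspos : 0 < s := by linarith
    have hLp : L - (p - 1) = L - p + 1 := by omega
    have hint : ∫⁻ u in Icc s (2 * s), b (p - 1) m u =
        (∫⁻ u in Icc s (2 * s), a (p - 1) m u) +
          ∫⁻ u in Icc s (2 * s), E m * ENNReal.ofReal u⁻¹ ^ (L - p + 1) := by
      rw [← lintegral_add_right' _
        (measurable_const_mul_ofReal_inv_pow (E m) (L - p + 1)).aemeasurable]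
      simp only [hb, hLp]
    have h1 : ∫⁻ u in Icc s (2 * s), a (p - 1) m u ≤
        C * ∑ i ∈ range (p + 1), b i (m + k) s + C * ∑ i ∈ range (p + 1), b i (m + k) s :=
      calc ∫⁻ u in Icc s (2 * s), a (p - 1) m u
          ≤ C * (∑ i ∈ range (p + 1), a i (m + k) s + e p (m + k) s) := hbulk p hp hpL m s hs
        _ = C * ∑ i ∈ range (p + 1), a i (m + k) s + C * e p (m + k) s := by ring
        _ ≤ C * ∑ i ∈ range (p + 1), b i (m + k) s + C * ∑ i ∈ range (p + 1), b i (m + k) s :=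
            add_le_add (mul_le_mul' le_rfl (hsum p (m + k) s))
              (mul_le_mul' le_rfl (((he p hpL (m + k) s hs).trans (hEb p (m + k) s)).trans
                (htop p (m + k) s)))
    have h2 : ∫⁻ u in Icc s (2 * s), E m * ENNReal.ofReal u⁻¹ ^ (L - p + 1) ≤
        ∑ i ∈ range (p + 1), b i (m + k) s :=
      calc ∫⁻ u in Icc s (2 * s), E m * ENNReal.ofReal u⁻¹ ^ (L - p + 1)
          ≤ E m * ENNReal.ofReal s⁻¹ ^ (L - p) := lintegral_const_mul_ofReal_inv_pow_le _ _ hspos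
        _ ≤ E (m + k) * ENNReal.ofReal s⁻¹ ^ (L - p) :=
            mul_le_mul' (hE m _ (Nat.le_add_right _ _)) le_rfl
        _ ≤ ∑ i ∈ range (p + 1), b i (m + k) s := (hEb p (m + k) s).trans (htop p (m + k) s)
    calc ∫⁻ u in Icc s (2 * s), b (p - 1) m u
        ≤ (C * ∑ i ∈ range (p + 1), b i (m + k) s + C * ∑ i ∈ range (p + 1), b i (m + k) s) +
            ∑ i ∈ range (p + 1), b i (m + k) s := by rw [hint]; exact add_le_add h1 h2
      _ = ((2 * C + 1 : ℝ≥0) : ℝ≥0∞) * ∑ i ∈ range (p + 1), b i (m + k) s := by push_cast; ring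
  -- (data) for `b`
  have hdata' : ∀ p, p ≤ L → ∀ m, b p m 1 ≤ D m + E m := by
    intro p hpL m
    calc b p m 1 = a p m 1 + E m * ENNReal.ofReal (1 : ℝ)⁻¹ ^ (L - p) := rfl
      _ = a p m 1 + E m := by rw [inv_one, ENNReal.ofReal_one, one_pow, mul_one]
      _ ≤ D m + E m := add_le_add (hdata p hpL m) le_rfl
  have h := hK b (fun m ↦ D m + E m) (fun m m' hmm' ↦ add_le_add (hD m m' hmm') (hE m m' hmm'))
    hmono' hbulk' hdata' p hpL m τ hτ
  exact (hab p m τ).trans h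

end DafermosRodnianski

end Literature.Geometry.Lorentzian

end
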